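import Summits.QuantumFields.BalabanUV.Beta.FP.TwoLevelDefectClosedForm

/-!
# `BalabanUV.Beta.FP.TwoLevelDefectPairing` — road «FP» for binder row D1, the N2b-WARD ENTRY EQUATION (owner d1-p3 gen 13, `LEAVES-FP.md` rows MS-1-GAUGE ∕
# N2b-WARD): THE TWO-LEVEL GAUGE-SLICE DEFECT PAIRED WITH TWO LEGS IS «(gauge quantity of the Γ_M-dressed leg on block y) × (divergence of the other leg against
# the bounded gauge potential θ_y)», summed over the M-blocks — hence it VANISHES when both legs are co-closed (an5's transverse telescoping `K1aTrans`, RE-DERIVED from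
# the closed form) and reduces to ONE Ward word when one leg is co-closed; every `d`, `N′ = M·L`; UNCONDITIONAL

HONEST DEPENDENCY (page 1, mandatory): continuum YM on T⁴ ⇐ BetaPertH ∧ nine spine estimates (0/9 proved); BetaPertH ⇐ (D1) ∧ (D4) ∧ CAP+tail;
G-an2-4 gates asym, D1 and NE2/3/4.  HONEST FRAMING (cell contract, verbatim): «discharging `BetaPertH` makes Bałaban's UV stability UNCONDITIONAL —
a real constructive-QFT result; it is NOT the continuum limit and NOT the Clay problem.»  THIS MODULE is [folklore]-grade bookkeeping over the owner's g13
`TwoLevelDefectClosedForm` ∕ `GaugeMultiplierBiLaplace` and an5's pairing toolkit (`lip1_dz`, `lip1_comm`).  No `def`, no `def … : Prop`, nothing cited, 0 sorry;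
0 estimates of Bałaban's constrained objects; 0∕4 row-D1 binders; NOT N2a∕N2b themselves (the Ward letters of the perfect jets are not touched), NOT the perfect level,
NOT (STEP)∕SDF, NOT D1, NOT BetaPertH, NOT continuum, NOT Clay.  «not in print; our bookkeeping».
ABSOLUTE RULE (cell charter, verbatim): «No internally-minted statement may enter as a cited fact. Every hypothesis is either kernel-proved in this package or a
verbatim quotation of a PUBLISHED theorem with page reference. The manuscript(s) under audit are NOT citable for their own disputed steps — they are the thing
under adjudication; programme-internal (2001/route/tribunal) claims are never citable.»

WHY.  Road FP's (STEP) door meets the gauge-slice defect `E = Γ_{N′} − Γ_M − PQ` INSIDE one-loop traces, paired with vertex legs `V₁`, `V₂` that are NOT co-closed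
(`JETS-JM-DESIGN.md` v2 §4 (c)).  With the closed form `E = Σ'_y (C_y ⊗ β_y + β_y ⊗ C_y)` (`twoLevelDefect_closedForm`) and `β_y = −dz θ_y`
(`blockSum_Mcol_eq_neg_dz`), a defect word is `Σ'_y [⟨V₁, C_y⟩·⟨V₂, β_y⟩ + ⟨V₁, β_y⟩·⟨V₂, C_y⟩]` with `⟨V, β_y⟩ = −⟨codiff₁ V, θ_y⟩` (summation by parts against the
BOUNDED potential `θ_y = Σ_{b ∈ box M} SbCol_{N′}(M•y+b)`) and `⟨V, C_y⟩ = (codiff₁∘dz∘codiff₁)(Γ_M V)(M•y)` = the (M-block-constant, (G)) gauge quantity of the level-`M`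
covariance field of the force `V`, read on block `y`.  So N2b = «the divergence letters of the perfect jets (Ward class displayed by `RoadLeftLiteralWardTables`) against the
potentials `θ_y`, weighted by the dressed partner's gauge quantity, have vanishing `(μ,ν)` second moment» — or a located stationary `δ ≠ 0`.  This is the model-level
picture of an5's `SliceComposition` (`Γ_P = Π Γ̃ Πᵀ`, `k1a_defect_eq_sliceChange`: the defect is the slice change between the composed and the one-shot slice, a gauge
direction on one leg) now at the level of the typed infinite-volume kernels.

CONTENT (every `d`; `N′ = M·L`, `M, L ≥ 1`; legs `V` finitely supported over a `Finset` of sites).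
* §1 `lip1_blockSumMcol_eq` (`⟨V, β_y⟩ = −⟨codiff₁ V, θ_y⟩` for bounded `V`), `sum_blockSumMcol_mul_eq` (finite-support form), `sum_mul_C_eq` (`⟨V, C_y⟩ =
  (δdδ GcolSum_M V)(M•y)`).
* §2 **`pair_twoLevelDefect`**: `Σ_{x∈s} Σ_{y∈s′} Σ_{κ,l} V₁ κ x · (Gam_{N′} − Gam_M − PQ)(κ,x;l,y) · V₂ l y
  = −Σ'_{y₀} [ (δdδ Γ_M V₁)(M•y₀) · ⟨codiff₁ V₂, θ_{y₀}⟩ + ⟨codiff₁ V₁, θ_{y₀}⟩ · (δdδ Γ_M V₂)(M•y₀) ]`.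
* §3 **`pair_twoLevelDefect_eq_zero_of_coclosed`** (both legs co-closed ⟹ `0`: an5's `K1aTrans` content re-derived from the closed form),
  **`pair_twoLevelDefect_of_coclosed_right`** (one leg co-closed ⟹ one Ward word).
Provenance: road «FP» OWNER, unit b2b-balaban-beta-d1-p3 gen 13 (prover-b2b-balaban-beta-d1-p3-g13-0), 2026-08-21; no existing file touched.
-/

noncomputable section

namespace Summit.QuantumFields.BalabanUV.Beta.FP.TwoLevelDefectPairing

open Finset
open scoped BigOperators
open Literature.MathematicalPhysics.QuantumFieldTheory
open Literature.MathematicalPhysics.QuantumFieldTheory.Balaban1983to89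
open Literature.MathematicalPhysics.QuantumFieldTheory.Balaban1983to89.Beta
open AffineAveraging (Form0 Form1 Form2 unitVec dz curv curvAdj codiff₁ box toSite blockSum contourSum)
open KKTFluctuationKernel (Gam GamM)
open KKTFluctuationEnergy (lip0 lip1 lip1_dz summable_mul_of_bdd summable_mul_of_bdd' Gcol Mcol GcolSum Gcol_bdd_summable)
open ResolventComposition (McolSum)
open ResolventCompositionStepB (PQ dz_finsum_mul codiff₁_finsum_mul)
open ScalarBlockGreen (lip1_comm lip0_comm)
open BiLaplaceBlockGreen (SbCol)
open GaugeMultiplierBiLaplace (blockSum_Mcol_eq_neg_dz theta_bdd_summable blockSumMcol_bdd_summable)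
open TwoLevelDefectClosedForm (twoLevelDefect_closedForm summable_C)

variable {d : ℕ} {N' M L : ℕ} [NeZero N'] [NeZero M] [NeZero L]

/-! ## §1 The two pairings: the pure-gauge leg by parts, the dressed leg as a gauge quantity -/

section Pairings

omit [NeZero M] [NeZero L] in
/-- [our proof] **THE PURE-GAUGE LEG BY PARTS**: for a bounded 1-form `V`, `⟨V, β_y⟩ = −⟨codiff₁ V, θ_y⟩` with `β_y(l,x′) = blockSum_M (Mcol_{N′} l x′) y = −(dz θ_y)(l,x′)`,
`θ_y = Σ_{b ∈ box M} SbCol_{N′}(M•y + b)` bounded and summable (`GaugeMultiplierBiLaplace`). -/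
theorem lip1_blockSumMcol_eq {V : Form1 (d + 1) ℝ} {B : ℝ} (hV : ∀ κ x, |V κ x| ≤ B) (y : AffineAveraging.Site (d + 1)) :
    lip1 V (fun l x' => blockSum M (Mcol (N := N') l x') y)
      = -lip0 (codiff₁ V) (fun u => ∑ b ∈ box (d + 1) M, SbCol (N := N') ((M : ℤ) • y + toSite b) u) := by
  obtain ⟨C, _, _, hθs⟩ := theta_bdd_summable (N' := N') (d := d) M
  have hrw : (fun l x' => blockSum M (Mcol (N := N') l x') y)
      = dz (fun u => -∑ b ∈ box (d + 1) M, SbCol (N := N') ((M : ℤ) • y + toSite b) u) := by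
    funext l x'
    rw [blockSum_Mcol_eq_neg_dz]
    simp only [dz]
    ring
  rw [hrw, lip1_dz hV (hθs y).neg]
  unfold KKTFluctuationEnergy.lip0
  rw [← tsum_neg]
  exact tsum_congr fun u => by ring

omit [NeZero M] [NeZero L] in
/-- [folklore] The same pairing for a leg supported over a finite set of sites, as a finite sum. -/
theorem sum_blockSumMcol_mul_eq (V : Form1 (d + 1) ℝ) (s : Finset (AffineAveraging.Site (d + 1))) (hs : ∀ κ x, x ∉ s → V κ x = 0)
    (y : AffineAveraging.Site (d + 1)) :
    (∑ x ∈ s, ∑ l, blockSum M (Mcol (N := N') l x) y * V l x)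
      = -lip0 (codiff₁ V) (fun u => ∑ b ∈ box (d + 1) M, SbCol (N := N') ((M : ℤ) • y + toSite b) u) := by
  have hB : ∀ κ x, |V κ x| ≤ ∑ x' ∈ s, ∑ κ', |V κ' x'| := by
    intro κ x
    by_cases hx : x ∈ s
    · exact (Finset.single_le_sum (f := fun κ' => |V κ' x|) (fun _ _ => abs_nonneg _) (Finset.mem_univ κ)).trans
        (Finset.single_le_sum (f := fun x' => ∑ κ', |V κ' x'|) (fun _ _ => Finset.sum_nonneg fun _ _ => abs_nonneg _) hx)
    · rw [hs κ x hx, abs_zero]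
      exact Finset.sum_nonneg fun _ _ => Finset.sum_nonneg fun _ _ => abs_nonneg _
  rw [← lip1_blockSumMcol_eq (N' := N') (M := M) hB y, lip1_comm]
  unfold KKTFluctuationEnergy.lip1
  exact (tsum_eq_sum (s := s) fun x hx => Finset.sum_eq_zero fun l _ => by rw [hs l x hx, mul_zero]).symm

omit [NeZero N'] [NeZero L] in
/-- [our proof] **THE DRESSED LEG IS A GAUGE QUANTITY**: `⟨V, C_y⟩ = Σ_{x∈s} Σ_κ V κ x · (δdδ Γ_M(·; κ,x))(M•y) = (δdδ (Γ_M V))(M•y)` — the gauge quantity (M-block-constant by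
(G), `isBlockConst_GcolSum`) of the level-`M` covariance field `Γ_M V = GcolSum_M (univ ×ˢ s) V` of the force `V`, read at the corner of block `y`. -/
theorem sum_mul_C_eq (V : Form1 (d + 1) ℝ) (s : Finset (AffineAveraging.Site (d + 1))) (y : AffineAveraging.Site (d + 1)) :
    (∑ x ∈ s, ∑ κ, V κ x * codiff₁ (dz (codiff₁ (Gcol (N := M) κ x))) ((M : ℤ) • y))
      = codiff₁ (dz (codiff₁ (GcolSum (N := M) (Finset.univ ×ˢ s) (Function.uncurry V)))) ((M : ℤ) • y) := by
  have hG : GcolSum (N := M) (Finset.univ ×ˢ s) (Function.uncurry V)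
      = fun κ' x' => ∑ b ∈ Finset.univ ×ˢ s, Function.uncurry V b * Gcol (N := M) b.1 b.2 κ' x' := rfl
  rw [hG, codiff₁_finsum_mul, dz_finsum_mul, codiff₁_finsum_mul]
  simp only [Finset.sum_product, Function.uncurry]
  rw [Finset.sum_comm]

end Pairings

/-! ## §2 The defect paired with two finitely supported legs -/

section Pair

/-- [our proof] **THE N2b ENTRY EQUATION: THE GAUGE-SLICE DEFECT PAIRED WITH TWO LEGS** (every `d`, `N′ = M·L`; `V₁`, `V₂` supported over the finite site sets `s`, `s′`):
`Σ_{x∈s} Σ_{y∈s′} Σ_{κ,l} V₁ κ x · (Gam_{N′} κ x l y − Gam_M κ x l y − PQ_{N′} M x y κ l) · V₂ l y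
 = −Σ'_{y₀} [ (δdδ Γ_M V₁)(M•y₀) · ⟨codiff₁ V₂, θ_{y₀}⟩ + ⟨codiff₁ V₁, θ_{y₀}⟩ · (δdδ Γ_M V₂)(M•y₀) ]` —
each defect word is the divergence of one leg against the bounded gauge potential of an M-block, weighted by the gauge quantity of the Γ_M-dressed other leg on that block. -/
theorem pair_twoLevelDefect (hN : N' = M * L) (V₁ V₂ : Form1 (d + 1) ℝ) (s s' : Finset (AffineAveraging.Site (d + 1)))
    (hs : ∀ κ x, x ∉ s → V₁ κ x = 0) (hs' : ∀ κ x, x ∉ s' → V₂ κ x = 0) :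
    (∑ x ∈ s, ∑ y ∈ s', ∑ κ : Fin (d + 1), ∑ l : Fin (d + 1),
        V₁ κ x * (Gam (N := N') κ x l y - Gam (N := M) κ x l y - PQ (N := N') M x y κ l) * V₂ l y)
      = -∑' y₀ : AffineAveraging.Site (d + 1),
          (codiff₁ (dz (codiff₁ (GcolSum (N := M) (Finset.univ ×ˢ s) (Function.uncurry V₁)))) ((M : ℤ) • y₀)
              * lip0 (codiff₁ V₂) (fun u => ∑ b ∈ box (d + 1) M, SbCol (N := N') ((M : ℤ) • y₀ + toSite b) u)
            + lip0 (codiff₁ V₁) (fun u => ∑ b ∈ box (d + 1) M, SbCol (N := N') ((M : ℤ) • y₀ + toSite b) u)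
              * codiff₁ (dz (codiff₁ (GcolSum (N := M) (Finset.univ ×ˢ s') (Function.uncurry V₂)))) ((M : ℤ) • y₀)) := by
  obtain ⟨Cβ, _, hβb, _⟩ := blockSumMcol_bdd_summable (N' := N') (d := d) M
  -- abbreviations for the two block families
  set Cf : Fin (d + 1) → AffineAveraging.Site (d + 1) → AffineAveraging.Site (d + 1) → ℝ :=
    fun κ x y₀ => codiff₁ (dz (codiff₁ (Gcol (N := M) κ x))) ((M : ℤ) • y₀) with hCf
  set βf : Fin (d + 1) → AffineAveraging.Site (d + 1) → AffineAveraging.Site (d + 1) → ℝ :=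
    fun l y y₀ => blockSum M (Mcol (N := N') l y) y₀ with hβf
  have hsum : ∀ κ x l y, Summable fun y₀ => V₁ κ x * (Cf κ x y₀ * βf l y y₀ + βf κ x y₀ * Cf l y y₀) * V₂ l y := by
    intro κ x l y
    have h1 : Summable fun y₀ => Cf κ x y₀ * βf l y y₀ := summable_mul_of_bdd' (summable_C (M := M) κ x) (fun y₀ => hβb y₀ l y)
    have h2 : Summable fun y₀ => βf κ x y₀ * Cf l y y₀ := summable_mul_of_bdd (fun y₀ => hβb y₀ κ x) (summable_C (M := M) l y)
    exact ((h1.add h2).mul_left (V₁ κ x)).mul_right (V₂ l y)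
  -- (1) insert the closed form and pull the `y₀`-series out of the finite sums
  have step1 : (∑ x ∈ s, ∑ y ∈ s', ∑ κ : Fin (d + 1), ∑ l : Fin (d + 1),
        V₁ κ x * (Gam (N := N') κ x l y - Gam (N := M) κ x l y - PQ (N := N') M x y κ l) * V₂ l y)
      = ∑' y₀, ∑ x ∈ s, ∑ y ∈ s', ∑ κ : Fin (d + 1), ∑ l : Fin (d + 1),
          V₁ κ x * (Cf κ x y₀ * βf l y y₀ + βf κ x y₀ * Cf l y y₀) * V₂ l y := by
    rw [Summable.tsum_finsetSum (fun x _ => summable_sum fun y _ => summable_sum fun κ _ => summable_sum fun l _ => hsum κ x l y)]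
    refine Finset.sum_congr rfl fun x _ => ?_
    rw [Summable.tsum_finsetSum (fun y _ => summable_sum fun κ _ => summable_sum fun l _ => hsum κ x l y)]
    refine Finset.sum_congr rfl fun y _ => ?_
    rw [Summable.tsum_finsetSum (fun κ _ => summable_sum fun l _ => hsum κ x l y)]
    refine Finset.sum_congr rfl fun κ _ => ?_
    rw [Summable.tsum_finsetSum (fun l _ => hsum κ x l y)]
    refine Finset.sum_congr rfl fun l _ => ?_
    rw [twoLevelDefect_closedForm (d := d) hN κ x l y, ← tsum_mul_left, ← tsum_mul_right]
  -- (2) regroup each `y₀`-slice into the two products of pairings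
  have step2 : ∀ y₀, (∑ x ∈ s, ∑ y ∈ s', ∑ κ : Fin (d + 1), ∑ l : Fin (d + 1),
        V₁ κ x * (Cf κ x y₀ * βf l y y₀ + βf κ x y₀ * Cf l y y₀) * V₂ l y)
      = (∑ x ∈ s, ∑ κ, V₁ κ x * Cf κ x y₀) * (∑ y ∈ s', ∑ l, βf l y y₀ * V₂ l y)
        + (∑ x ∈ s, ∑ κ, βf κ x y₀ * V₁ κ x) * (∑ y ∈ s', ∑ l, V₂ l y * Cf l y y₀) := by
    intro y₀
    simp only [Finset.sum_mul_sum, ← Finset.sum_add_distrib]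
    refine Finset.sum_congr rfl fun x _ => Finset.sum_congr rfl fun y _ =>
      Finset.sum_congr rfl fun κ _ => Finset.sum_congr rfl fun l _ => ?_
    ring
  rw [step1, tsum_congr step2, ← tsum_neg]
  refine tsum_congr fun y₀ => ?_
  rw [sum_mul_C_eq (M := M) V₁ s y₀, sum_blockSumMcol_mul_eq (N' := N') (M := M) V₂ s' hs' y₀,
    sum_blockSumMcol_mul_eq (N' := N') (M := M) V₁ s hs y₀,
    show (∑ y ∈ s', ∑ l, V₂ l y * Cf l y y₀) = ∑ y ∈ s', ∑ l, V₂ l y * codiff₁ (dz (codiff₁ (Gcol (N := M) l y))) ((M : ℤ) • y₀) from rfl,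
    sum_mul_C_eq (M := M) V₂ s' y₀]
  ring

end Pair

/-! ## §3 Co-closed legs: an5's transverse telescoping re-derived; one Ward word when one leg is co-closed -/

section Coclosed

/-- [our proof] **BOTH LEGS CO-CLOSED ⟹ THE DEFECT PAIRING VANISHES** — an5's `K1aTrans` content (`ResolventCompositionStepB.k1aTrans`, there via the energy argument and
superpositions) re-derived from the CLOSED FORM: every word contains a `codiff₁` of a leg. -/
theorem pair_twoLevelDefect_eq_zero_of_coclosed (hN : N' = M * L) (V₁ V₂ : Form1 (d + 1) ℝ) (s s' : Finset (AffineAveraging.Site (d + 1)))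
    (hs : ∀ κ x, x ∉ s → V₁ κ x = 0) (hs' : ∀ κ x, x ∉ s' → V₂ κ x = 0) (hco : codiff₁ V₁ = 0) (hco' : codiff₁ V₂ = 0) :
    (∑ x ∈ s, ∑ y ∈ s', ∑ κ : Fin (d + 1), ∑ l : Fin (d + 1),
        V₁ κ x * (Gam (N := N') κ x l y - Gam (N := M) κ x l y - PQ (N := N') M x y κ l) * V₂ l y) = 0 := by
  rw [pair_twoLevelDefect (d := d) hN V₁ V₂ s s' hs hs', hco, hco']
  simp [KKTFluctuationEnergy.lip0]

/-- [our proof] **ONE LEG CO-CLOSED ⟹ ONE WARD WORD**: if `V₂` is co-closed only the word with the divergence of `V₁` survives: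
`Σ V₁ (Gam_{N′} − Gam_M − PQ) V₂ = −Σ'_{y₀} ⟨codiff₁ V₁, θ_{y₀}⟩ · (δdδ Γ_M V₂)(M•y₀)`. -/
theorem pair_twoLevelDefect_of_coclosed_right (hN : N' = M * L) (V₁ V₂ : Form1 (d + 1) ℝ) (s s' : Finset (AffineAveraging.Site (d + 1)))
    (hs : ∀ κ x, x ∉ s → V₁ κ x = 0) (hs' : ∀ κ x, x ∉ s' → V₂ κ x = 0) (hco' : codiff₁ V₂ = 0) :
    (∑ x ∈ s, ∑ y ∈ s', ∑ κ : Fin (d + 1), ∑ l : Fin (d + 1),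
        V₁ κ x * (Gam (N := N') κ x l y - Gam (N := M) κ x l y - PQ (N := N') M x y κ l) * V₂ l y)
      = -∑' y₀ : AffineAveraging.Site (d + 1),
          lip0 (codiff₁ V₁) (fun u => ∑ b ∈ box (d + 1) M, SbCol (N := N') ((M : ℤ) • y₀ + toSite b) u)
            * codiff₁ (dz (codiff₁ (GcolSum (N := M) (Finset.univ ×ˢ s') (Function.uncurry V₂)))) ((M : ℤ) • y₀) := by
  rw [pair_twoLevelDefect (d := d) hN V₁ V₂ s s' hs hs', hco']
  simp [KKTFluctuationEnergy.lip0]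

end Coclosed

end Summit.QuantumFields.BalabanUV.Beta.FP.TwoLevelDefectPairing

end
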